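import Summits.ABC.IUTFork.Joshi.DictionaryUntiltsVolume
import Mathlib.Analysis.SpecialFunctions.Log.Basic
import HarnessLib

/-!
# The [J-I] cluster vs `S`: the volume read-out of Joshi's scaling exponent, RE-TYPED — any FAITHFUL read-out (the log-volume
# determines the exponent) carries p431910's location; the LOGARITHMIC read-out is the one compatible with translating realisations

Dictionary/test-side file of the abc-iut cell, branch E (seat abc-iut-E-t1, [J-I] carrier owner; lane (1) «[J-I] cluster vs S» of
abc-iut-E-cx-3; rung LADDER-ABC:A2.E). TAKES NO SIDE on [IUTchIII] Cor. 3.12 or on any author; typed ≠ proved ≠ endorsed.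

WHY THIS FILE. `DictionaryUntiltsVolume` (p431910) located the [J-I] cluster through the sentence `ExponentFaithful`: «in some packet
`logvol (ρ (datum y)) = κ · exponent y`, `κ ≠ 0`» — a LINEAR read-out of Joshi's scaling exponent `c_y` ([J-I] v4 Thm 5.4.1 / Cor 5.4.2,
`‖·‖_{K_y} = ‖·‖^{c_y}` on `Q̄_p`, p431060) by log-volumes. abc-iut-E-cx-3's `TestUntiltsReadout` showed that THIS READ-OUT IS STRUCTURALLY
UNREALISABLE: exponents are positive and moves form a group, so no move translates a linear read-out by a constant; hence on a dilating
signature `DatumEquivariant ∧ ExponentFaithful` fails at BOTH models of record (S false: TestUntiltsPinned §6; S true: X-07′), a «Y-UNSAT»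
residual that cannot co-vary with `S` — with the re-typing handed to this seat. The mathematics behind the objection: a dilatation
`|−|_{K₂} = |−|^{λ}_{K₁}` MULTIPLIES exponents, while every realisation of a move inside the tensor-packet containers — volume-preserving
(Ind1)/(Ind2) of the models of record, or the Joshi-style `p`-power scalings of X-07′ — SHIFTS log-volumes additively (by `0`, resp. by
`k·log p`). The read-out under which «multiply the exponent by `λ`» IS «shift the log-volume by a constant» is the LOGARITHMIC one,
`logvol = κ · log (exponent) + c` — and along a Frobenius orbit of the Fargues–Fontaine curve the exponent is multiplied by `p` at each step
(`‖·‖_{K_{φ(y)}} = ‖·‖^p_{K_y}` on the tilt side), exactly as the `𝔮`-parameter region `q^k·𝒪` loses `log q` of volume per power.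

WHAT IS HERE (E-plan R13: residuals BY DECL NAME).
* §1 `ExponentReadout` — the GENERAL faithful read-out: in some packet the log-volume of the read region is an INJECTIVE function (on the
  positive reals, where exponents live: `exponent_pos`) of the scaling exponent. `ExponentFaithful` (linear, p431910) and the new
  `ExponentLogFaithful` (logarithmic) are both instances (`exponentReadout_of_exponentFaithful`, `exponentReadout_of_exponentLogFaithful`).
* §2 p431910's LOCATION GENERALISED to every faithful read-out: `exponent_ptAct_eq_of_readout`, `not_actionDilates_of_readout`,
  **`not_movesAreInd_and_datumEquivariant_of_readout`** (and `…_of_logFaithful`): GIVEN `ActionDilates`, a `ρ`-equivariant faithful reading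
  cannot have `MovesAreInd ∧ DatumEquivariant` where the (Ind1)/(Ind2) generators preserve admissibility and log-volume — the proof of
  p431910 used only injectivity. So `MRData.LogvolInvariant` REMAINS the load-bearing hypothesis for the whole class of faithful read-outs;
  E-cx-3's sharpening (the linear read-out dies WITHOUT `LogvolInvariant`) is specific to linearity.
* §3 the logarithmic read-out is COMPATIBLE with volume-TRANSLATING realisations: under `ExponentLogFaithful` at `(j, v_ℚ)`, a move that
  dilates UNIFORMLY (`exponent (σ·y) = λ · exponent y` for all `y`) shifts the read log-volumes by the constant `κ · log λ`
  (`logvol_shift_of_logFaithful`), and conversely a constant shift `d` along a uniformly-`λ`-dilating move forces `d = κ · log λ`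
  (`shift_eq_of_logFaithful`) — contrast E-cx-3's `not_exponentFaithful_of_logvol_shift` (linear: every shift is `0`). The companion
  files `UntiltFrobeniusLine` (a [J-I] points-model with a uniformly dilating move of infinite order) and `TestUntiltsFrobeniusLine`
  (the log-faithful [J-I] dictionary REALISED at X-07′, S derived by the E1 route; refuted at the pinned countermodel) make the re-typed
  residual CO-VARY with `S`. Nothing of print is asserted; candidate sentences are `def`s, never hypotheses-free theorems.
[claim: Joshi2021ATS1, status: disputed]
-/

noncomputable section

open Set

namespace Summit.ABC.IUTFork.Joshi

namespace UntiltPoints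

open Summit.ABC.IUTFork.Thm311 Summit.ABC.IUTFork.Cor312 Summit.ABC.IUTFork.Cor312Vol

variable {p : ℕ} [Fact p.Prime] {𝒪E : Type} [CommRing 𝒪E] {T : ThetaIndex}

/-! ## 1. Faithful read-outs of the scaling exponent by log-volumes -/

/-- **`ExponentReadout` (candidate dictionary sentence, E1 side ↔ volumes, GENERAL form):** in SOME packet `(j, v_ℚ)` the log-volume of
the `ρ`-region of the datum read in the holomorphic structure `y` is an INJECTIVE function — on the positive reals, where the exponents
live — of the scaling exponent `c_y = exponent D y` of `K_y` (`‖·‖_{K_y} = ‖·‖^{c_y}` on `Q̄_p`, [J-I] v4 Thm 5.4.1, p431060): the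
log-volumes SEE Joshi's deformation parameter. The linear `ExponentFaithful` (p431910) and the logarithmic `ExponentLogFaithful` are
instances. Never asserted. [claim: Joshi2021ATS1, status: disputed] -/
@[claim "Joshi2021ATS1" "disputed"]
def ExponentReadout (D : UntiltPoints p 𝒪E) (S : LatticeSituation T) (n : ℤ)
    (ρ : (∀ v : T.V, v ∈ T.Vbad → Set (S.L.StarPacket v)) → ∀ (j : T.Label) (vQ : T.VQ), Set (S.L.Packet j vQ))
    (datum : D.Pt → ∀ v : T.V, v ∈ T.Vbad → Set (S.L.StarPacket v)) : Prop :=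
  ∃ (j : T.Label) (vQ : T.VQ) (f : ℝ → ℝ), InjOn f (Ioi 0) ∧
    ∀ y : D.Pt, (S.D n).logvol j vQ (ρ (datum y) j vQ) = f (D.exponent y)

/-- **`ExponentLogFaithful` (candidate dictionary sentence, the LOGARITHMIC read-out):** in some packet the log-volume of the read region
is `κ · log (c_y) + c` with `κ ≠ 0` — the read-out under which a dilatation `c ↦ λ·c` ([J-I] v4 Cor 5.4.2; the Frobenius translate of a
Fargues–Fontaine point: `λ = p`) is an ADDITIVE shift of log-volume by `κ · log λ` (as `q^k·𝒪 ↦ q^{k+1}·𝒪` loses `log q`). Never asserted.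
[claim: Joshi2021ATS1, status: disputed] -/
@[claim "Joshi2021ATS1" "disputed"]
def ExponentLogFaithful (D : UntiltPoints p 𝒪E) (S : LatticeSituation T) (n : ℤ)
    (ρ : (∀ v : T.V, v ∈ T.Vbad → Set (S.L.StarPacket v)) → ∀ (j : T.Label) (vQ : T.VQ), Set (S.L.Packet j vQ))
    (datum : D.Pt → ∀ v : T.V, v ∈ T.Vbad → Set (S.L.StarPacket v)) : Prop :=
  ∃ (j : T.Label) (vQ : T.VQ) (κ c : ℝ), κ ≠ 0 ∧
    ∀ y : D.Pt, (S.D n).logvol j vQ (ρ (datum y) j vQ) = κ * Real.log (D.exponent y) + c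

variable {D : UntiltPoints p 𝒪E} {S : LatticeSituation T} (n : ℤ)
  (ρ : (∀ v : T.V, v ∈ T.Vbad → Set (S.L.StarPacket v)) → ∀ (j : T.Label) (vQ : T.VQ), Set (S.L.Packet j vQ))
  {base std : D.Pt} {datum : D.Pt → ∀ v : T.V, v ∈ T.Vbad → Set (S.L.StarPacket v)} {real : D.Aut → S.L.PacketAut}

/-- The linear read-out of p431910 is a faithful read-out (`t ↦ κ·t` is injective for `κ ≠ 0`). [folklore] -/
theorem exponentReadout_of_exponentFaithful (h : ExponentFaithful D S n ρ datum) : ExponentReadout D S n ρ datum := by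
  obtain ⟨j, vQ, κ, hκ, hf⟩ := h
  exact ⟨j, vQ, fun t => κ * t, (mul_right_injective₀ hκ).injOn, hf⟩

/-- The logarithmic read-out is a faithful read-out (`log` is injective on the positive reals). [folklore] -/
theorem exponentReadout_of_exponentLogFaithful (h : ExponentLogFaithful D S n ρ datum) : ExponentReadout D S n ρ datum := by
  obtain ⟨j, vQ, κ, c, hκ, hf⟩ := h
  refine ⟨j, vQ, fun t => κ * Real.log t + c, fun s hs t ht hst => ?_, hf⟩
  have h1 : κ * Real.log s = κ * Real.log t := by
    have := hst
    simp only at this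
    linarith
  exact Real.log_injOn_pos hs ht (mul_left_cancel₀ hκ h1)

/-! ## 2. p431910's location, generalised to every faithful read-out -/

/-- Under §1 of p431910 (orbit-constancy of log-volumes: (hρ), (hAdm), `LogvolInvariant`, admissibility, `MovesAreInd`, `DatumEquivariant`)
and ANY faithful read-out, the scaling EXPONENT is constant on `Aut_{𝒪_E}(𝒢(𝒪_F))`-orbits. [folklore] -/
theorem exponent_ptAct_eq_of_readout
    (hρ : ∀ Φ ∈ Subgroup.closure (S.L.Ind1Family ∪ S.L.Ind2Family),
      ∀ (Ψ : ∀ v : T.V, v ∈ T.Vbad → Set (S.L.StarPacket v)) (j : T.Label) (vQ : T.VQ),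
        ρ (fun v hv => S.L.starAut Φ v '' Ψ v hv) j vQ = Φ j vQ '' ρ Ψ j vQ)
    (hAdm : ∀ Φ ∈ S.L.Ind1Family ∪ S.L.Ind2Family, ∀ (j : T.Label) (vQ : T.VQ) (A : Set (S.L.Packet j vQ)),
      (S.D n).Adm j vQ A ↔ (S.D n).Adm j vQ (Φ j vQ '' A))
    (hvol : (S.D n).LogvolInvariant)
    (hadm : ∀ (y : D.Pt) (j : T.Label) (vQ : T.VQ), (S.D n).Adm j vQ (ρ (datum y) j vQ))
    (hM : MovesAreInd (D.toDictionary S base std datum real))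
    (hE : DatumEquivariant (D.toDictionary S base std datum real))
    (hX : ExponentReadout D S n ρ datum) (σ : D.Aut) (y : D.Pt) :
    D.exponent (D.ptAct σ y) = D.exponent y := by
  obtain ⟨j, vQ, f, hf, hfaith⟩ := hX
  have h := logvol_datum_ptAct_eq n ρ hρ hAdm hvol hadm hM hE σ y j vQ
  rw [hfaith, hfaith] at h
  exact hf (D.exponent_pos _) (D.exponent_pos _) h

/-- **NO DILATATION at volume-invariant indeterminacies, for every faithful read-out**: `¬ ActionDilates`. [folklore] -/
theorem not_actionDilates_of_readout
    (hρ : ∀ Φ ∈ Subgroup.closure (S.L.Ind1Family ∪ S.L.Ind2Family),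
      ∀ (Ψ : ∀ v : T.V, v ∈ T.Vbad → Set (S.L.StarPacket v)) (j : T.Label) (vQ : T.VQ),
        ρ (fun v hv => S.L.starAut Φ v '' Ψ v hv) j vQ = Φ j vQ '' ρ Ψ j vQ)
    (hAdm : ∀ Φ ∈ S.L.Ind1Family ∪ S.L.Ind2Family, ∀ (j : T.Label) (vQ : T.VQ) (A : Set (S.L.Packet j vQ)),
      (S.D n).Adm j vQ A ↔ (S.D n).Adm j vQ (Φ j vQ '' A))
    (hvol : (S.D n).LogvolInvariant)
    (hadm : ∀ (y : D.Pt) (j : T.Label) (vQ : T.VQ), (S.D n).Adm j vQ (ρ (datum y) j vQ))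
    (hM : MovesAreInd (D.toDictionary S base std datum real))
    (hE : DatumEquivariant (D.toDictionary S base std datum real))
    (hX : ExponentReadout D S n ρ datum) : ¬ D.ActionDilates := by
  rw [D.actionDilates_iff_exponent_ne]
  rintro ⟨σ, y, hne⟩
  exact hne (exponent_ptAct_eq_of_readout n ρ hρ hAdm hvol hadm hM hE hX σ y)

/-- **THE [J-I]-CLUSTER LOCATION FOR EVERY FAITHFUL READ-OUT (orbit form; p431910 generalised).** GIVEN Joshi's non-uniformity claim
`ActionDilates` ([J-I] v4 Cor 5.4.2), a `ρ`-equivariant reading whose log-volumes DETERMINE the scaling exponent (`ExponentReadout`)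
cannot satisfy `MovesAreInd ∧ DatumEquivariant` where the (Ind1)/(Ind2) generators preserve admissibility and log-volume
(`MRData.LogvolInvariant`). «¬(MovesAreInd ∧ DatumEquivariant) follows from (ActionDilates, ExponentReadout, hρ, hAdm, LogvolInvariant,
admissibility) as typed» — located, not adjudicated; whether the (Ind1)/(Ind2) of [IUTchIII] Thm 3.11 are volume-invariant at the
intended instantiation is E-PLAN Q2 / X-06. [claim: Joshi2021ATS1, status: disputed] -/
theorem not_movesAreInd_and_datumEquivariant_of_readout
    (hρ : ∀ Φ ∈ Subgroup.closure (S.L.Ind1Family ∪ S.L.Ind2Family),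
      ∀ (Ψ : ∀ v : T.V, v ∈ T.Vbad → Set (S.L.StarPacket v)) (j : T.Label) (vQ : T.VQ),
        ρ (fun v hv => S.L.starAut Φ v '' Ψ v hv) j vQ = Φ j vQ '' ρ Ψ j vQ)
    (hAdm : ∀ Φ ∈ S.L.Ind1Family ∪ S.L.Ind2Family, ∀ (j : T.Label) (vQ : T.VQ) (A : Set (S.L.Packet j vQ)),
      (S.D n).Adm j vQ A ↔ (S.D n).Adm j vQ (Φ j vQ '' A))
    (hvol : (S.D n).LogvolInvariant)
    (hadm : ∀ (y : D.Pt) (j : T.Label) (vQ : T.VQ), (S.D n).Adm j vQ (ρ (datum y) j vQ))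
    (hX : ExponentReadout D S n ρ datum) (hDil : D.ActionDilates) :
    ¬ (MovesAreInd (D.toDictionary S base std datum real) ∧ DatumEquivariant (D.toDictionary S base std datum real)) :=
  fun h => not_actionDilates_of_readout n ρ hρ hAdm hvol hadm h.1 h.2 hX hDil

/-- The location for the LOGARITHMIC read-out (the instance the Frobenius-line test realises at X-07′). [claim: Joshi2021ATS1, status: disputed] -/
theorem not_movesAreInd_and_datumEquivariant_of_logFaithful
    (hρ : ∀ Φ ∈ Subgroup.closure (S.L.Ind1Family ∪ S.L.Ind2Family),
      ∀ (Ψ : ∀ v : T.V, v ∈ T.Vbad → Set (S.L.StarPacket v)) (j : T.Label) (vQ : T.VQ),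
        ρ (fun v hv => S.L.starAut Φ v '' Ψ v hv) j vQ = Φ j vQ '' ρ Ψ j vQ)
    (hAdm : ∀ Φ ∈ S.L.Ind1Family ∪ S.L.Ind2Family, ∀ (j : T.Label) (vQ : T.VQ) (A : Set (S.L.Packet j vQ)),
      (S.D n).Adm j vQ A ↔ (S.D n).Adm j vQ (Φ j vQ '' A))
    (hvol : (S.D n).LogvolInvariant)
    (hadm : ∀ (y : D.Pt) (j : T.Label) (vQ : T.VQ), (S.D n).Adm j vQ (ρ (datum y) j vQ))
    (hX : ExponentLogFaithful D S n ρ datum) (hDil : D.ActionDilates) :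
    ¬ (MovesAreInd (D.toDictionary S base std datum real) ∧ DatumEquivariant (D.toDictionary S base std datum real)) :=
  not_movesAreInd_and_datumEquivariant_of_readout n ρ hρ hAdm hvol hadm (exponentReadout_of_exponentLogFaithful n ρ hX) hDil

/-- The same located statement read positively: at volume-invariant indeterminacies, a faithful equivariant [J-I] dictionary forces all
holomorphic structures in one orbit to induce THE SAME absolute value on `Q̄_p` (`IsDilatation y (σ·y) 1`). [folklore] -/
theorem isDilatation_one_of_readout
    (hρ : ∀ Φ ∈ Subgroup.closure (S.L.Ind1Family ∪ S.L.Ind2Family),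
      ∀ (Ψ : ∀ v : T.V, v ∈ T.Vbad → Set (S.L.StarPacket v)) (j : T.Label) (vQ : T.VQ),
        ρ (fun v hv => S.L.starAut Φ v '' Ψ v hv) j vQ = Φ j vQ '' ρ Ψ j vQ)
    (hAdm : ∀ Φ ∈ S.L.Ind1Family ∪ S.L.Ind2Family, ∀ (j : T.Label) (vQ : T.VQ) (A : Set (S.L.Packet j vQ)),
      (S.D n).Adm j vQ A ↔ (S.D n).Adm j vQ (Φ j vQ '' A))
    (hvol : (S.D n).LogvolInvariant)
    (hadm : ∀ (y : D.Pt) (j : T.Label) (vQ : T.VQ), (S.D n).Adm j vQ (ρ (datum y) j vQ))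
    (hM : MovesAreInd (D.toDictionary S base std datum real))
    (hE : DatumEquivariant (D.toDictionary S base std datum real))
    (hX : ExponentReadout D S n ρ datum) (σ : D.Aut) (y : D.Pt) :
    D.IsDilatation y (D.ptAct σ y) 1 := by
  rw [D.isDilatation_iff_eq_div, exponent_ptAct_eq_of_readout n ρ hρ hAdm hvol hadm hM hE hX σ y,
    div_self (D.exponent_pos y).ne']

/-! ## 3. The logarithmic read-out turns uniform dilatations into constant volume shifts -/

/-- **Log read-out: a uniformly dilating move shifts the read log-volumes by a constant.** If at `(j, v_ℚ)` the read log-volume is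
`κ · log (c_y) + c` and the move `σ` dilates uniformly by `λ > 0` (`c_{σ·y} = λ · c_y` for all `y`), then
`logvol (ρ (datum (σ·y))) = logvol (ρ (datum y)) + κ · log λ` for all `y` — the multiplicative law of exponents becomes the additive law
of log-volumes (what a `p`-power scaling of a packet line does to balls). [folklore] -/
theorem logvol_shift_of_logFaithful {j : T.Label} {vQ : T.VQ} {κ c : ℝ}
    (hf : ∀ y : D.Pt, (S.D n).logvol j vQ (ρ (datum y) j vQ) = κ * Real.log (D.exponent y) + c)
    (σ : D.Aut) {lam : ℝ} (hlam : 0 < lam) (hσ : ∀ y : D.Pt, D.exponent (D.ptAct σ y) = lam * D.exponent y) (y : D.Pt) :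
    (S.D n).logvol j vQ (ρ (datum (D.ptAct σ y)) j vQ) = (S.D n).logvol j vQ (ρ (datum y) j vQ) + κ * Real.log lam := by
  rw [hf, hf, hσ, Real.log_mul hlam.ne' (D.exponent_pos y).ne']
  ring

/-- Conversely, under the log read-out a CONSTANT shift `d` of the read log-volumes along a uniformly-`λ`-dilating move is forced to be
`κ · log λ` (one point suffices) — in particular `d ≠ 0` as soon as `λ ≠ 1`: the log read-out SEES the dilatation as a non-zero volume
shift, where E-cx-3's `not_exponentFaithful_of_logvol_shift` shows the linear read-out sees only the shift `0`. [folklore] -/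
theorem shift_eq_of_logFaithful {j : T.Label} {vQ : T.VQ} {κ c : ℝ}
    (hf : ∀ y : D.Pt, (S.D n).logvol j vQ (ρ (datum y) j vQ) = κ * Real.log (D.exponent y) + c)
    (σ : D.Aut) {lam : ℝ} (hlam : 0 < lam) (hσ : ∀ y : D.Pt, D.exponent (D.ptAct σ y) = lam * D.exponent y) {d : ℝ}
    (y₀ : D.Pt) (hd : (S.D n).logvol j vQ (ρ (datum (D.ptAct σ y₀)) j vQ) = (S.D n).logvol j vQ (ρ (datum y₀) j vQ) + d) :
    d = κ * Real.log lam := by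
  rw [logvol_shift_of_logFaithful n ρ hf σ hlam hσ y₀] at hd
  linarith

/-- … so for `κ ≠ 0` and `λ ≠ 1` the shift is NON-ZERO. [folklore] -/
theorem shift_ne_zero_of_logFaithful {j : T.Label} {vQ : T.VQ} {κ c : ℝ} (hκ : κ ≠ 0)
    (hf : ∀ y : D.Pt, (S.D n).logvol j vQ (ρ (datum y) j vQ) = κ * Real.log (D.exponent y) + c)
    (σ : D.Aut) {lam : ℝ} (hlam : 0 < lam) (hlam1 : lam ≠ 1)
    (hσ : ∀ y : D.Pt, D.exponent (D.ptAct σ y) = lam * D.exponent y) (y : D.Pt) :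
    (S.D n).logvol j vQ (ρ (datum (D.ptAct σ y)) j vQ) ≠ (S.D n).logvol j vQ (ρ (datum y) j vQ) := by
  rw [logvol_shift_of_logFaithful n ρ hf σ hlam hσ y]
  intro h
  have h0 : κ * Real.log lam = 0 := by linarith
  rcases mul_eq_zero.1 h0 with h1 | h1
  · exact hκ h1
  · exact hlam1 (Real.eq_one_of_pos_of_log_eq_zero hlam h1)

end UntiltPoints

end Summit.ABC.IUTFork.Joshi

end
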